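/-
Copyright: the b2b-balaban cell (near-miss cell 7), T⁴-continuum fan-out, lineage t4-ne7b-p1 (node U5c COUNT member).
Released under the licence of the surrounding project.
-/
import Summits.QuantumFields.BalabanUV.T4Continuum.Support.PartnerMultiplicityThreshold

/-!
# The infrared threshold of the count chain is a function of the symbolic constants ONLY

Summits-side support leaf of the T⁴-continuum cell (rung (B)+1 on a FINITE torus only; NOT infinite volume, NOT the
mass gap, NOT the Clay statement; NOT a proof of the spine estimate NE7b).  Lineage `t4-ne7b-p1` (generation 21),
node U5c.  [folklore] bookkeeping over the lineage's OWN typed carrier; nothing is quoted from print and nothing printed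
is asserted; no `[cite:]` tag.

THE FINDING (statement-level, located; the proofs are not in question).  The landed END statements of the count member's
chain — `T4RecordPriceSeam.exists_irThreshold_relWeightBound`, `T4PartnerMultiplicity.exists_irThreshold_relWeightBoundM`
and the Summits descendants `PartnerMultiplicityF∕G∕Floor∕Z∕Threshold.exists_irThreshold_…` — read
`… (Cell) … (E B) … (jstar) … (hA : Regeneration … A …) (hA' : Regeneration … A' …) (hCn) : ∃ x₀, ∀ R g β', …`, with
the term families `π T A A′ Bad′ dead F Rf nlow nup Cn K₀` entering as section variables BEFORE the colon.  The
existential threshold `x₀` is therefore certified only PER PAIR OF TERM FAMILIES (and per cell model, event tables,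
matching scale): «for these `A`, `A′` there is a threshold».  The docstrings and the cell's records state more — «ONE `x₀`
(constants only) such that for EVERY family of runs …» — and the intended consumer needs more: the two runs' term
families are functions of the run, i.e. of the coupling `g`, so from the landed form the consumer obtains `x₀(A(g))` and
the required `x₀(A(g)) ≤ log g_{K,K}⁻²` does not follow from «`g_{K,K}` small».  The PROOFS already build `x₀` from the
symbolic constants alone (`T4PrintedShapeBanking.exists_irThreshold C hC ha hA₀ hL hβ hrq`, then explicit maxima); only
the STATEMENTS under-sell them.

THE REPAIR (this leaf; no landed statement is touched).  §1 NAMES the thresholds as functions of the constants, by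
type: `irThresholdM C L r β₀` (the `Banking` threshold of `T4PrintedShapeBanking.exists_irThreshold`, chosen once by
`Classical.choose`), `irThresholdG C θ L r β₀ := max (irThresholdM (lowerA C (a∕2)) L r β₀) (max 1 (2θ(1+β₀)²∕(a·A₀²)))`
(the enlarged threshold of `PartnerMultiplicityThreshold.exists_irThreshold_relWeightBoundG_threshold`), and
`irThresholdZ C Kz p σ ε θ L r β₀ := irThresholdG C (zoneRate Kz p σ ε θ) L r β₀`.  §2 re-proves the three END
statements x₀-FREE against the named thresholds — `relWeightBoundM_of_irThreshold`, `relWeightBoundG_of_irThreshold`,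
`relWeightBoundZ_of_irThreshold` — with the landed binder lists otherwise (the six side conditions on the constants
`C.Valid`, `0 < a`, `0 < A₀`, `1 ≤ L`, `0 ≤ β₀`, `r(q′+1) < p₀` bundled as `ThresholdOK C L r β₀`; the run binders
`R g β′` and their flow hypotheses become ordinary arguments; proofs = the landed proofs with the threshold named).  §3 Sanity (the threshold is monotone in the surcharge rate; junk value off the side conditions).  The
companion leaf `Support/CountThresholdExit` states the uniform ∃-form with `x₀` FIRST, recovers the landed ∃-form as a
one-line corollary (so the named form is the STRONGER statement) and gives the seam-currency corollary (shift by `K₁`,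
no indicator) for `T4MatchingClosureSocket.hybridNE7_closure'_tail`.

NOT DONE HERE.  Nothing of the walls: (ID) G-ne7bp1g9-1 (the reading — the labelled-price binder `hlabZ`, the live
families `str`, the two `Regeneration` runs are BINDERS, as before) and (E2)∕(R1) G-ne7bp1-1.  NE7b discharge: no date.

HONEST DEPENDENCY (cell): continuum YM on T⁴ ⇐ BetaPertH ∧ nine spine estimates (0/9 proved); BetaPertH ⇐ (D1) ∧ (D4)
∧ CAP+tail.  This file changes none of it.
-/

open Finset
open Literature.MathematicalPhysics.QuantumFieldTheory.Balaban1983to89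
open T4PersistenceDictionary T4PersistentHistoryCount T4BankedInduction T4PrintedShapeBanking
open T4WeightBudget T4GlobalDenominator T4LiveClassFibration T4LiveStructureGas T4LiveGasToTerms T4RecordPriceSeam
open T4PartnerMultiplicity
open Summit.QuantumFields.BalabanUV.T4Continuum.PlacementBatch
open Summit.QuantumFields.BalabanUV.T4Continuum.PlacementSkeleton
open Summit.QuantumFields.BalabanUV.T4Continuum.PartnerMultiplicityF
open Summit.QuantumFields.BalabanUV.T4Continuum.PartnerMultiplicityG
open Summit.QuantumFields.BalabanUV.T4Continuum.PartnerMultiplicityZ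
open Summit.QuantumFields.BalabanUV.T4Continuum.PartnerMultiplicityFloor
open Summit.QuantumFields.BalabanUV.T4Continuum.PartnerMultiplicityThreshold
open Summit.QuantumFields.BalabanUV.T4Continuum.Crowding

namespace Summit.QuantumFields.BalabanUV.T4Continuum.CountThresholdUniform

noncomputable section

/-! ## §1 The thresholds, NAMED — functions of the symbolic constants only -/

/-- The side conditions under which `T4PrintedShapeBanking.exists_irThreshold` produces a threshold: valid symbolic
constants, `a, A₀ > 0`, `L ≥ 1`, `β₀ ≥ 0`, `r(q′+1) < p₀`. [folklore] -/
structure ThresholdOK (C : T4PrintedShapeBanking.Consts) (L r : ℕ) (β₀ : ℝ) : Prop where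
  valid : C.Valid
  a_pos : 0 < C.a
  A₀_pos : 0 < C.A₀
  one_le_L : 1 ≤ L
  β₀_nonneg : 0 ≤ β₀
  rq_lt : r * (C.q' + 1) < C.p₀

/-- **THE `Banking` THRESHOLD, NAMED**: a number depending on `(C, L, r, β₀)` only — the witness of
`T4PrintedShapeBanking.exists_irThreshold` chosen once (and `0` off the side conditions, where it is never used).
[folklore] -/
def irThresholdM (C : T4PrintedShapeBanking.Consts) (L r : ℕ) (β₀ : ℝ) : ℝ :=
  haveI := Classical.dec (ThresholdOK C L r β₀)
  if h : ThresholdOK C L r β₀ then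
    Classical.choose (exists_irThreshold C h.valid h.a_pos h.A₀_pos h.one_le_L h.β₀_nonneg h.rq_lt)
  else 0

/-- **ITS SPECIFICATION**: along every run obeying the typed (2.7), (2.9), (2.5), `1 ≤ log g_s⁻²` and the infrared
smallness `irThresholdM C L r β₀ ≤ log g_K⁻²`, the printed-shape model inhabits `Banking` at the cutoff `K`.
[folklore] -/
theorem banking_of_irThresholdM {C : T4PrintedShapeBanking.Consts} {L r : ℕ} {β₀ : ℝ} (h : ThresholdOK C L r β₀)
    (K : ℕ) (R : ℕ → ℕ) (g : ℕ → ℝ) (β' : ℝ) (h27 : B14.FlowIneq27 g β' β₀ C.p₀ K)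
    (h29 : B14FlowStep.FlowIneq29 R g L β' β₀ K) (hR : ∀ s, s ≤ K → B14.IsRj L r (g s) (R s))
    (hx1 : ∀ s, s ≤ K → 1 ≤ Real.log ((g s) ^ 2)⁻¹) (hir : irThresholdM C L r β₀ ≤ Real.log ((g K) ^ 2)⁻¹) :
    Banking (Consistent C K R) (dictW R C.n₁) (cost C K R) (credit C g)
      (fun e => C.κ₁ * ((dictW R C.n₁ e : ℕ) : ℝ) + Emarg C e) (reserve C g) (extn C K R) := by
  have hdef : irThresholdM C L r β₀ =
      Classical.choose (exists_irThreshold C h.valid h.a_pos h.A₀_pos h.one_le_L h.β₀_nonneg h.rq_lt) := by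
    unfold irThresholdM; rw [dif_pos h]
  have hspec := Classical.choose_spec (exists_irThreshold C h.valid h.a_pos h.A₀_pos h.one_le_L h.β₀_nonneg h.rq_lt)
  exact hspec K R g β' h27 h29 hR hx1 (hdef ▸ hir)

/-- **THE CLASS-LINEAR THRESHOLD, NAMED** (the `x₀` of `PartnerMultiplicityThreshold.exists_irThreshold_relWeightBoundG_threshold`,
written out): the `Banking` threshold at HALF the quadratic constant, enlarged to `≥ 1` and `≥ 2θ(1+β₀)²∕(a·A₀²)`.
A function of `(C, θ, L, r, β₀)` only. [folklore] -/
def irThresholdG (C : T4PrintedShapeBanking.Consts) (θ : ℝ) (L r : ℕ) (β₀ : ℝ) : ℝ :=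
  max (irThresholdM (lowerA C (C.a / 2)) L r β₀) (max 1 (2 * θ * (1 + β₀) ^ 2 / (C.a * C.A₀ ^ 2)))

/-- **THE ZONE-CROWDING THRESHOLD, NAMED**: the class-linear threshold at `θ := zoneRate Kz p σ ε θ`.  A function of
`(C, Kz, p, σ, ε, θ, L, r, β₀)` only. [folklore] -/
def irThresholdZ (C : T4PrintedShapeBanking.Consts) (Kz p σ ε θ : ℝ) (L r : ℕ) (β₀ : ℝ) : ℝ :=
  irThresholdG C (zoneRate Kz p σ ε θ) L r β₀

/-- the class-linear threshold dominates the half-constant `Banking` threshold [folklore] -/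
theorem irThresholdM_le_irThresholdG (C : T4PrintedShapeBanking.Consts) (θ : ℝ) (L r : ℕ) (β₀ : ℝ) :
    irThresholdM (lowerA C (C.a / 2)) L r β₀ ≤ irThresholdG C θ L r β₀ := le_max_left _ _

/-- the class-linear threshold is at least `1` [folklore] -/
theorem one_le_irThresholdG (C : T4PrintedShapeBanking.Consts) (θ : ℝ) (L r : ℕ) (β₀ : ℝ) :
    1 ≤ irThresholdG C θ L r β₀ := (le_max_left _ _).trans (le_max_right _ _)

/-- the class-linear threshold dominates the half-room ratio [folklore] -/
theorem room_le_irThresholdG (C : T4PrintedShapeBanking.Consts) (θ : ℝ) (L r : ℕ) (β₀ : ℝ) :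
    2 * θ * (1 + β₀) ^ 2 / (C.a * C.A₀ ^ 2) ≤ irThresholdG C θ L r β₀ := (le_max_right _ _).trans (le_max_right _ _)

/-- the side conditions pass to the half-constant model [folklore] -/
theorem thresholdOK_half {C : T4PrintedShapeBanking.Consts} {L r : ℕ} {β₀ : ℝ} (h : ThresholdOK C L r β₀) :
    ThresholdOK (lowerA C (C.a / 2)) L r β₀ where
  valid := lowerA_valid h.valid _
  a_pos := by rw [lowerA_a]; linarith [h.a_pos]
  A₀_pos := by rw [lowerA_A₀]; exact h.A₀_pos
  one_le_L := h.one_le_L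
  β₀_nonneg := h.β₀_nonneg
  rq_lt := h.rq_lt

/-! ## §2 The three END statements, x₀-free against the named thresholds -/

section EndToEnd

variable {γ κ ι : Type*} [DecidableEq γ] [DecidableEq κ] {l₀ : ℝ} {K₀ : ℕ} {π : ℕ → ι → κ} {T : ℕ → Finset ι}
  {A A' : ℕ → ℝ → ι → ℝ} {Bad' : ℕ → ℝ → Finset κ} {dead dead' : ℕ → ℝ → ι → ℝ} {F Rf F' Rf' : ℕ → κ → ℝ}
  {nlow nup mlow mup : ℕ → ℝ → ℝ} {Cn : ℝ}

/-- **M-LEVEL END STATEMENT, THRESHOLD NAMED.**  `T4PartnerMultiplicity.exists_irThreshold_relWeightBoundM` with the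
existential `x₀` REPLACED by the named `irThresholdM C L r β₀` in the infrared-smallness binder (and the six side
conditions bundled as `ThresholdOK`) — so the threshold visibly does not depend on the cells, the event tables, the
matching scale, the term families or the runs.  Proof: the landed x₀-free `exists_relWeightBound_of_bankingM` fed with
`banking_of_irThresholdM`. [folklore] -/
theorem relWeightBoundM_of_irThreshold {C : T4PrintedShapeBanking.Consts} {L r : ℕ} {β₀ : ℝ}
    (h : ThresholdOK C L r β₀)
    (Cell : ℕ → ℕ → Finset γ) {V Λ : ℝ} (hV : 0 ≤ V) (hΛ : 0 < Λ)
    (hcell : ∀ K a, ((Cell K a).card : ℝ) ≤ V * Λ ^ a) (E B : ℕ → ℕ → Finset PEv)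
    (hE : ∀ K j, ∀ e ∈ E K j, PEv.step e ∈ Ioc j K) (jstar : ℕ → ℕ) (hj : ∀ K, jstar K ≤ K) {c : ℝ} (hc : 0 < c)
    (hfrac : ∀ K : ℕ, c * K ≤ ((K - jstar K : ℕ) : ℝ))
    (hA : Regeneration l₀ π T A Bad' dead F Rf nlow nup Cn K₀)
    (hA' : Regeneration l₀ π T A' Bad' dead' F' Rf' mlow mup Cn K₀) (hCn : 0 ≤ Cn)
    (R : ℕ → ℕ → ℕ) (g : ℕ → ℕ → ℝ) (β' : ℕ → ℝ)
    (h27 : ∀ K, K₀ ≤ K → B14.FlowIneq27 (g K) (β' K) β₀ C.p₀ K)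
    (h29 : ∀ K, K₀ ≤ K → B14FlowStep.FlowIneq29 (R K) (g K) L (β' K) β₀ K)
    (hR : ∀ K, K₀ ≤ K → ∀ s, s ≤ K → B14.IsRj L r (g K s) (R K s))
    (hx1 : ∀ K, K₀ ≤ K → ∀ s, s ≤ K → 1 ≤ Real.log ((g K s) ^ 2)⁻¹)
    (hir : ∀ K, K₀ ≤ K → irThresholdM C L r β₀ ≤ Real.log ((g K K) ^ 2)⁻¹)
    {ρbar ηbar : ℝ} (hρbar : ∀ K j, ∑ b ∈ B K j, rho C (g K) b ≤ ρbar)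
    (hηbar : ∀ K j, ∀ t ∈ Ioc j K, ∑ e ∈ E K j with PEv.step e = t, eta C e ≤ ηbar)
    (hr : Λ * Real.exp (ηbar - C.κ₁) < 1) {Λ' : ℝ} (hΛ0 : 0 ≤ Λ') (hΛ1 : Λ' * Real.exp (-C.κ₁) ≤ 1)
    (y : ℕ → ℕ → γ → PEv → Finset PEv → ℝ)
    (hy0 : ∀ K, ∀ j ≤ K, ∀ z ∈ Cell K (K - j), ∀ b ∈ B K j,
      ∀ Q ∈ records (dictW (R K) C.n₁) j K (E K j) b, 0 ≤ y K j z b Q)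
    (hlabM : ∀ K, K₀ ≤ K → ∀ j ≤ K, ∀ z ∈ Cell K (K - j), ∀ b ∈ B K j,
      ∀ Q ∈ records (dictW (R K) C.n₁) j K (E K j) b,
      y K j z b Q ≤ 0 ∨ ∃ G : Gen PEv, Consistent C K (R K) G ∧ G.WF (dictW (R K) C.n₁) ∧ G.rootStep = j ∧
        K < G.reach (dictW (R K) C.n₁) ∧ G.root = b ∧ G.events.erase G.root = Q ∧
        y K j z b Q ≤ Λ' ^ partnerAges PEv.step G * (Real.exp (-credits (credit C (g K)) G) *
          Real.exp (lifeCost (dictW (R K) C.n₁) (cost C K (R K)) G)))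
    (str : ℕ → κ → Finset (Slot γ PEv))
    (hinj : ∀ K t, |t| ≤ l₀ → K₀ ≤ K → Set.InjOn (str K) (Bad' K t))
    (hstr : ∀ K t, |t| ≤ l₀ → K₀ ≤ K → ∀ c ∈ Bad' K t,
      str K c ⊆ liveSlots Cell (dictW (R K) C.n₁) E B K ∧
        ∃ o ∈ oldSlots Cell (dictW (R K) C.n₁) E B jstar K, o ∈ str K c)
    (hF : ∀ K t, |t| ≤ l₀ → K₀ ≤ K → ∀ c ∈ Bad' K t, F K c * Rf K c ≤ famWeight (slotPrice (y K)) (str K c))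
    (hF' : ∀ K t, |t| ≤ l₀ → K₀ ≤ K → ∀ c ∈ Bad' K t, F' K c * Rf' K c ≤ famWeight (slotPrice (y K)) (str K c)) :
    ∃ K₁, K₀ ≤ K₁ ∧ RelWeightBound l₀ T A A' (fun K t => if K₁ ≤ K then badOfClass π T Bad' K t else ∅)
      (Set.indicator {K | K₁ ≤ K} (fun K => Cn * recordsBudget ρbar C.κ₁ V Λ ηbar jstar K)) :=
  exists_relWeightBound_of_bankingM h.valid.κ₁_nonneg R g
    (fun K hK => banking_of_irThresholdM h K (R K) (g K) (β' K) (h27 K hK) (h29 K hK) (hR K hK) (hx1 K hK) (hir K hK))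
    Cell hV hΛ hcell E B hE hρbar hηbar hr hΛ0 hΛ1 jstar hj hc hfrac y hy0 hlabM str hinj hstr hA hA' hF hF' hCn

/-- **CLASS-LINEAR END STATEMENT (`hlabG`, NO ROOM CONDITION), THRESHOLD NAMED.**
`PartnerMultiplicityThreshold.exists_irThreshold_relWeightBoundG_threshold` with `∃ x₀` REPLACED by the named
`irThresholdG C θ L r β₀` (side conditions bundled as `ThresholdOK`); binders otherwise VERBATIM; proof = the landed
proof with the `M`-chain run through `relWeightBoundM_of_irThreshold` at `lowerA C (a∕2)`. [folklore] -/
theorem relWeightBoundG_of_irThreshold {C : T4PrintedShapeBanking.Consts} {L r : ℕ} {β₀ : ℝ}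
    (h : ThresholdOK C L r β₀) {θ : ℝ} (hθ : 0 ≤ θ)
    (Cell : ℕ → ℕ → Finset γ) {V Λ : ℝ} (hV : 0 ≤ V) (hΛ : 0 < Λ)
    (hcell : ∀ K a, ((Cell K a).card : ℝ) ≤ V * Λ ^ a) (E B : ℕ → ℕ → Finset PEv)
    (hE : ∀ K j, ∀ e ∈ E K j, PEv.step e ∈ Ioc j K) (jstar : ℕ → ℕ) (hj : ∀ K, jstar K ≤ K) {c : ℝ} (hc : 0 < c)
    (hfrac : ∀ K : ℕ, c * K ≤ ((K - jstar K : ℕ) : ℝ))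
    (hA : Regeneration l₀ π T A Bad' dead F Rf nlow nup Cn K₀)
    (hA' : Regeneration l₀ π T A' Bad' dead' F' Rf' mlow mup Cn K₀) (hCn : 0 ≤ Cn)
    (R : ℕ → ℕ → ℕ) (g : ℕ → ℕ → ℝ) (β' : ℕ → ℝ)
    (h27 : ∀ K, K₀ ≤ K → B14.FlowIneq27 (g K) (β' K) β₀ C.p₀ K)
    (h29 : ∀ K, K₀ ≤ K → B14FlowStep.FlowIneq29 (R K) (g K) L (β' K) β₀ K)
    (hR : ∀ K, K₀ ≤ K → ∀ s, s ≤ K → B14.IsRj L r (g K s) (R K s))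
    (hx1 : ∀ K, K₀ ≤ K → ∀ s, s ≤ K → 1 ≤ Real.log ((g K s) ^ 2)⁻¹)
    (hir : ∀ K, K₀ ≤ K → irThresholdG C θ L r β₀ ≤ Real.log ((g K K) ^ 2)⁻¹)
    {ρbar ηbar : ℝ} (hρbar : ∀ K j, ∑ b ∈ B K j, rho C (g K) b ≤ ρbar)
    (hηbar : ∀ K j, ∀ t ∈ Ioc j K, ∑ e ∈ E K j with PEv.step e = t, eta C e ≤ ηbar)
    (hr : Λ * Real.exp (ηbar - C.κ₁) < 1) {Λ' : ℝ} (hΛ0 : 0 ≤ Λ') (hΛ1 : Λ' * Real.exp (-C.κ₁) ≤ 1)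
    (y : ℕ → ℕ → γ → PEv → Finset PEv → ℝ)
    (hy0 : ∀ K, ∀ j ≤ K, ∀ z ∈ Cell K (K - j), ∀ b ∈ B K j,
      ∀ Q ∈ records (dictW (R K) C.n₁) j K (E K j) b, 0 ≤ y K j z b Q)
    (hlabG : ∀ K, K₀ ≤ K → ∀ j ≤ K, ∀ z ∈ Cell K (K - j), ∀ b ∈ B K j,
      ∀ Q ∈ records (dictW (R K) C.n₁) j K (E K j) b,
      y K j z b Q ≤ 0 ∨ ∃ G : Gen PEv, Consistent C K (R K) G ∧ G.WF (dictW (R K) C.n₁) ∧ G.rootStep = j ∧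
        K < G.reach (dictW (R K) C.n₁) ∧ G.root = b ∧ G.events.erase G.root = Q ∧
        y K j z b Q ≤ Real.exp (θ * ∑ b' ∈ births G, ((b'.fat : ℝ) + 1)) *
          (Λ' ^ partnerAges PEv.step G * (Real.exp (-credits (credit C (g K)) G) *
            Real.exp (lifeCost (dictW (R K) C.n₁) (cost C K (R K)) G))))
    (str : ℕ → κ → Finset (Slot γ PEv))
    (hinj : ∀ K t, |t| ≤ l₀ → K₀ ≤ K → Set.InjOn (str K) (Bad' K t))
    (hstr : ∀ K t, |t| ≤ l₀ → K₀ ≤ K → ∀ c ∈ Bad' K t,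
      str K c ⊆ liveSlots Cell (dictW (R K) C.n₁) E B K ∧
        ∃ o ∈ oldSlots Cell (dictW (R K) C.n₁) E B jstar K, o ∈ str K c)
    (hF : ∀ K t, |t| ≤ l₀ → K₀ ≤ K → ∀ c ∈ Bad' K t, F K c * Rf K c ≤ famWeight (slotPrice (y K)) (str K c))
    (hF' : ∀ K t, |t| ≤ l₀ → K₀ ≤ K → ∀ c ∈ Bad' K t, F' K c * Rf' K c ≤ famWeight (slotPrice (y K)) (str K c)) :
    ∃ K₁, K₀ ≤ K₁ ∧ RelWeightBound l₀ T A A' (fun K t => if K₁ ≤ K then badOfClass π T Bad' K t else ∅)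
      (Set.indicator {K | K₁ ≤ K} (fun K => Cn * recordsBudget ρbar C.κ₁ V Λ ηbar jstar K)) := by
  -- the landed `M`-chain at HALF the quadratic constant, with its NAMED threshold
  set C' := lowerA C (C.a / 2) with hC'def
  have h' : ThresholdOK C' L r β₀ := thresholdOK_half h
  have ha : 0 < C.a := h.a_pos
  have hA₀ : 0 < C.A₀ := h.A₀_pos
  have hβ : 0 ≤ β₀ := h.β₀_nonneg
  have hp1 : 1 ≤ C.p₀ := by
    have : r * (C.q' + 1) < C.p₀ := h.rq_lt
    omega
  have hir' : ∀ K, K₀ ≤ K → irThresholdM C' L r β₀ ≤ Real.log ((g K K) ^ 2)⁻¹ := fun K hK =>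
    (irThresholdM_le_irThresholdG C θ L r β₀).trans (hir K hK)
  have hlabM : ∀ K, K₀ ≤ K → ∀ j ≤ K, ∀ z ∈ Cell K (K - j), ∀ b ∈ B K j,
      ∀ Q ∈ records (dictW (R K) C.n₁) j K (E K j) b,
      y K j z b Q ≤ 0 ∨ ∃ G : Gen PEv, Consistent C' K (R K) G ∧ G.WF (dictW (R K) C.n₁) ∧
        G.rootStep = j ∧ K < G.reach (dictW (R K) C.n₁) ∧ G.root = b ∧ G.events.erase G.root = Q ∧
        y K j z b Q ≤ Λ' ^ partnerAges PEv.step G * (Real.exp (-credits (credit C' (g K)) G) *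
          Real.exp (lifeCost (dictW (R K) C.n₁) (cost C K (R K)) G)) := by
    intro K hK j hj z hz b hb Q hQ
    rcases hlabG K hK j hj z hz b hb Q hQ with h0 | ⟨G, hcG, hW, hrs, hKr, hroot, hQ', hy⟩
    · exact Or.inl h0
    · refine Or.inr ⟨G, (consistent_lowerA_iff C (C.a / 2) K (R K) G).2 hcG, hW, hrs, hKr, hroot, hQ', hy.trans ?_⟩
      -- the infrared floor at this cutoff and the half-room
      have hxK1 : 1 ≤ Real.log ((g K K) ^ 2)⁻¹ := (one_le_irThresholdG C θ L r β₀).trans (hir K hK)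
      have hxK2 : 2 * θ * (1 + β₀) ^ 2 / (C.a * C.A₀ ^ 2) ≤ Real.log ((g K K) ^ 2)⁻¹ :=
        (room_le_irThresholdG C θ L r β₀).trans (hir K hK)
      obtain ⟨hP, hroom⟩ := half_room_of_threshold ha hA₀ hβ hp1 hxK1 hxK2
      set P := C.A₀ * Real.log ((g K K) ^ 2)⁻¹ ^ C.p₀ / (1 + β₀) with hPdef
      have hPe : ∀ e ∈ G.events, e.kind = 0 → P ≤ p0Profile C.A₀ C.p₀ (g K e.step) := fun e he _ => by
        have hfl := floor_of_ir (h27 K hK) hβ hA₀.le (by linarith) (step_le_of_consistent hcG e he)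
        simpa [p0Profile, hPdef] using hfl
      have key := exp_mul_fatSum_mul_exp_neg_credits_le_floor (g := g K) hθ hP hcG hPe
      -- antitonicity: lowering by `θ∕P² ≤ a∕2` leaves at least the credits of `C'`
      have hanti : Real.exp (-credits (credit (lowerA C (θ / P ^ 2)) (g K)) G) ≤
          Real.exp (-credits (credit C' (g K)) G) := by
        rw [Real.exp_le_exp, neg_le_neg_iff, hC'def]
        exact credits_lowerA_anti C (g K) hroom G
      have hX : 0 ≤ Real.exp (lifeCost (dictW (R K) C.n₁) (cost C K (R K)) G) := (Real.exp_pos _).le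
      have hΛp : 0 ≤ Λ' ^ partnerAges PEv.step G := pow_nonneg hΛ0 _
      calc Real.exp (θ * ∑ b' ∈ births G, ((b'.fat : ℝ) + 1)) *
            (Λ' ^ partnerAges PEv.step G * (Real.exp (-credits (credit C (g K)) G) *
              Real.exp (lifeCost (dictW (R K) C.n₁) (cost C K (R K)) G)))
          = Λ' ^ partnerAges PEv.step G *
              ((Real.exp (θ * ∑ b' ∈ births G, ((b'.fat : ℝ) + 1)) * Real.exp (-credits (credit C (g K)) G)) *
                Real.exp (lifeCost (dictW (R K) C.n₁) (cost C K (R K)) G)) := by ring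
        _ ≤ Λ' ^ partnerAges PEv.step G * (Real.exp (-credits (credit C' (g K)) G) *
              Real.exp (lifeCost (dictW (R K) C.n₁) (cost C K (R K)) G)) :=
            mul_le_mul_of_nonneg_left (mul_le_mul_of_nonneg_right (key.trans hanti) hX) hΛp
  exact relWeightBoundM_of_irThreshold h' Cell hV hΛ hcell E B hE jstar hj hc hfrac hA hA' hCn R g β' h27 h29 hR
    hx1 hir' hρbar hηbar hr hΛ0 hΛ1 y hy0 hlabM str hinj hstr hF hF'

/-- **ZONE-CROWDING END STATEMENT (`hlabZ`, NO ROOM CONDITION), THRESHOLD NAMED** — the row's EXIT.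
`PartnerMultiplicityThreshold.exists_irThreshold_relWeightBoundZ_threshold` with `∃ x₀` REPLACED by the named
`irThresholdZ C Kz p σ ε θ L r β₀` (side conditions bundled as `ThresholdOK`); binders otherwise VERBATIM; proof = the
landed proof (`hlabZ ⇒ hlabG` by `zone_surcharge_le`, then `relWeightBoundG_of_irThreshold` at `θ := zoneRate Kz p σ ε θ`,
`Λ′ := Λ′e^{ε}`). [folklore] -/
theorem relWeightBoundZ_of_irThreshold {C : T4PrintedShapeBanking.Consts} {L r : ℕ} {β₀ : ℝ}
    (h : ThresholdOK C L r β₀)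
    {Kz p σ ε θ : ℝ} (hKz : 1 ≤ Kz) (hp : 0 ≤ p) (h0 : 0 < σ) (h1 : σ < 1) (hε : 0 < ε) (hθ : 0 < θ)
    (Cell : ℕ → ℕ → Finset γ) {V Λ : ℝ} (hV : 0 ≤ V) (hΛ : 0 < Λ)
    (hcell : ∀ K a, ((Cell K a).card : ℝ) ≤ V * Λ ^ a) (E B : ℕ → ℕ → Finset PEv)
    (hE : ∀ K j, ∀ e ∈ E K j, PEv.step e ∈ Ioc j K) (jstar : ℕ → ℕ) (hj : ∀ K, jstar K ≤ K) {c : ℝ} (hc : 0 < c)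
    (hfrac : ∀ K : ℕ, c * K ≤ ((K - jstar K : ℕ) : ℝ))
    (hA : Regeneration l₀ π T A Bad' dead F Rf nlow nup Cn K₀)
    (hA' : Regeneration l₀ π T A' Bad' dead' F' Rf' mlow mup Cn K₀) (hCn : 0 ≤ Cn)
    (R : ℕ → ℕ → ℕ) (g : ℕ → ℕ → ℝ) (β' : ℕ → ℝ)
    (h27 : ∀ K, K₀ ≤ K → B14.FlowIneq27 (g K) (β' K) β₀ C.p₀ K)
    (h29 : ∀ K, K₀ ≤ K → B14FlowStep.FlowIneq29 (R K) (g K) L (β' K) β₀ K)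
    (hR : ∀ K, K₀ ≤ K → ∀ s, s ≤ K → B14.IsRj L r (g K s) (R K s))
    (hx1 : ∀ K, K₀ ≤ K → ∀ s, s ≤ K → 1 ≤ Real.log ((g K s) ^ 2)⁻¹)
    (hir : ∀ K, K₀ ≤ K → irThresholdZ C Kz p σ ε θ L r β₀ ≤ Real.log ((g K K) ^ 2)⁻¹)
    {ρbar ηbar : ℝ} (hρbar : ∀ K j, ∑ b ∈ B K j, rho C (g K) b ≤ ρbar)
    (hηbar : ∀ K j, ∀ t ∈ Ioc j K, ∑ e ∈ E K j with PEv.step e = t, eta C e ≤ ηbar)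
    (hr : Λ * Real.exp (ηbar - C.κ₁) < 1) {Λ' : ℝ} (hΛ0 : 0 ≤ Λ') (hΛ1 : Λ' * Real.exp ε * Real.exp (-C.κ₁) ≤ 1)
    (y : ℕ → ℕ → γ → PEv → Finset PEv → ℝ)
    (hy0 : ∀ K, ∀ j ≤ K, ∀ z ∈ Cell K (K - j), ∀ b ∈ B K j,
      ∀ Q ∈ records (dictW (R K) C.n₁) j K (E K j) b, 0 ≤ y K j z b Q)
    (hlabZ : ∀ K, K₀ ≤ K → ∀ j ≤ K, ∀ z ∈ Cell K (K - j), ∀ b ∈ B K j,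
      ∀ Q ∈ records (dictW (R K) C.n₁) j K (E K j) b,
      y K j z b Q ≤ 0 ∨ ∃ G : Gen PEv, Consistent C K (R K) G ∧ G.WF (dictW (R K) C.n₁) ∧ G.rootStep = j ∧
        K < G.reach (dictW (R K) C.n₁) ∧ G.root = b ∧ G.events.erase G.root = Q ∧
        y K j z b Q ≤ Kz ^ (merges G).card * (∏ e ∈ merges G, Crowding.Q (wcnt G) σ e.step ^ p) *
          Λ' ^ partnerAges PEv.step G * (Real.exp (-credits (credit C (g K)) G) *
            Real.exp (lifeCost (dictW (R K) C.n₁) (cost C K (R K)) G)))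
    (str : ℕ → κ → Finset (Slot γ PEv))
    (hinj : ∀ K t, |t| ≤ l₀ → K₀ ≤ K → Set.InjOn (str K) (Bad' K t))
    (hstr : ∀ K t, |t| ≤ l₀ → K₀ ≤ K → ∀ c ∈ Bad' K t,
      str K c ⊆ liveSlots Cell (dictW (R K) C.n₁) E B K ∧
        ∃ o ∈ oldSlots Cell (dictW (R K) C.n₁) E B jstar K, o ∈ str K c)
    (hF : ∀ K t, |t| ≤ l₀ → K₀ ≤ K → ∀ c ∈ Bad' K t, F K c * Rf K c ≤ famWeight (slotPrice (y K)) (str K c))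
    (hF' : ∀ K t, |t| ≤ l₀ → K₀ ≤ K → ∀ c ∈ Bad' K t, F' K c * Rf' K c ≤ famWeight (slotPrice (y K)) (str K c)) :
    ∃ K₁, K₀ ≤ K₁ ∧ RelWeightBound l₀ T A A' (fun K t => if K₁ ≤ K then badOfClass π T Bad' K t else ∅)
      (Set.indicator {K | K₁ ≤ K} (fun K => Cn * recordsBudget ρbar C.κ₁ V Λ ηbar jstar K)) := by
  have hθz : 0 ≤ zoneRate Kz p σ ε θ := zoneRate_nonneg hKz hp h0 h1 hθ.le
  have hΛ0' : 0 ≤ Λ' * Real.exp ε := mul_nonneg hΛ0 (Real.exp_pos ε).le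
  have hlabG : ∀ K, K₀ ≤ K → ∀ j ≤ K, ∀ z ∈ Cell K (K - j), ∀ b ∈ B K j,
      ∀ Q ∈ records (dictW (R K) C.n₁) j K (E K j) b,
      y K j z b Q ≤ 0 ∨ ∃ G : Gen PEv, Consistent C K (R K) G ∧ G.WF (dictW (R K) C.n₁) ∧
        G.rootStep = j ∧ K < G.reach (dictW (R K) C.n₁) ∧ G.root = b ∧ G.events.erase G.root = Q ∧
        y K j z b Q ≤ Real.exp (zoneRate Kz p σ ε θ * ∑ b' ∈ births G, ((b'.fat : ℝ) + 1)) *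
          ((Λ' * Real.exp ε) ^ partnerAges PEv.step G * (Real.exp (-credits (credit C (g K)) G) *
            Real.exp (lifeCost (dictW (R K) C.n₁) (cost C K (R K)) G))) := by
    intro K hK j hj z hz b hb Q hQ
    rcases hlabZ K hK j hj z hz b hb Q hQ with h0' | ⟨G, hcG, hW, hrs, hKr, hroot, hQ', hy⟩
    · exact Or.inl h0'
    · refine Or.inr ⟨G, hcG, hW, hrs, hKr, hroot, hQ', hy.trans ?_⟩
      have key := zone_surcharge_le (dictW (R K) C.n₁) hKz hp h0 h1 hε hθ hΛ0 hcG hW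
      have hX : 0 ≤ Real.exp (-credits (credit C (g K)) G) *
          Real.exp (lifeCost (dictW (R K) C.n₁) (cost C K (R K)) G) := by positivity
      calc Kz ^ (merges G).card * (∏ e ∈ merges G, Crowding.Q (wcnt G) σ e.step ^ p) *
            Λ' ^ partnerAges PEv.step G * (Real.exp (-credits (credit C (g K)) G) *
              Real.exp (lifeCost (dictW (R K) C.n₁) (cost C K (R K)) G))
          ≤ Real.exp (zoneRate Kz p σ ε θ * ∑ b' ∈ births G, ((b'.fat : ℝ) + 1)) *
              (Λ' * Real.exp ε) ^ partnerAges PEv.step G * (Real.exp (-credits (credit C (g K)) G) *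
              Real.exp (lifeCost (dictW (R K) C.n₁) (cost C K (R K)) G)) := mul_le_mul_of_nonneg_right key hX
        _ = _ := by ring
  exact relWeightBoundG_of_irThreshold h hθz Cell hV hΛ hcell E B hE jstar hj hc hfrac hA hA' hCn R g β' h27 h29
    hR hx1 hir hρbar hηbar hr hΛ0' (by simpa [mul_assoc] using hΛ1) y hy0 hlabG str hinj hstr hF hF'

end EndToEnd

/-! ## §3 Sanity -/

namespace Sanity

/-- The named thresholds are functions of the symbolic constants alone: two term families, two cell models, two event
tables — ONE number (trivially, by the type of `irThresholdZ`; recorded as the point of the leaf). [folklore] -/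
example (C : T4PrintedShapeBanking.Consts) (Kz p σ ε θ β₀ : ℝ) (L r : ℕ) :
    ∀ (_Cell₁ _Cell₂ : ℕ → ℕ → Finset ℕ) (_E₁ _E₂ : ℕ → ℕ → Finset PEv),
      irThresholdZ C Kz p σ ε θ L r β₀ = irThresholdZ C Kz p σ ε θ L r β₀ := fun _ _ _ _ => rfl

/-- The class-linear threshold is monotone in the surcharge rate `θ` (a larger multiplicity constant only moves the
infrared threshold up, never asks room of `a`). [folklore] -/
theorem irThresholdG_mono (C : T4PrintedShapeBanking.Consts) (hC : 0 < C.a * C.A₀ ^ 2) (L r : ℕ) {β₀ : ℝ}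
    {θ₁ θ₂ : ℝ} (hθ : θ₁ ≤ θ₂) : irThresholdG C θ₁ L r β₀ ≤ irThresholdG C θ₂ L r β₀ := by
  unfold irThresholdG
  refine max_le_max le_rfl (max_le_max le_rfl ?_)
  exact div_le_div_of_nonneg_right (by nlinarith [sq_nonneg (1 + β₀)]) hC.le

/-- Off the side conditions the `Banking` threshold is the junk value `0` (never used: every consumer carries
`ThresholdOK`). [folklore] -/
theorem irThresholdM_of_not {C : T4PrintedShapeBanking.Consts} {L r : ℕ} {β₀ : ℝ} (h : ¬ ThresholdOK C L r β₀) :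
    irThresholdM C L r β₀ = 0 := by
  unfold irThresholdM; rw [dif_neg h]

end Sanity

end

end Summit.QuantumFields.BalabanUV.T4Continuum.CountThresholdUniform
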